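import Summits.QuantumFields.YangMills.Theorems.BalabanLadderIRTwistedSlabHodgeDeterminant
import HarnessLib

/-!
# The tangent-space decomposition at a twist-eating vacuum: infinitesimal gauge modes ⊕ Coulomb slice = all traceless fluctuations, as a
# LINEAR ISOMORPHISM `(φ, y) ↦ ∇⁺φ + y` (the algebraic heart of the slice chart M1b)

HELPER toward stub **T1** `TwistedSlabAnchor` (LINE `twisted-slab-continuity`, crux `IRcof` stmt-QuantumFields-26930, census row 43;
LEAD prover ym-ir-line-tsc-p1 g3; `--supports` the crux, `--as helper`).  Sequel of `…TwistedSlabHodgeDeterminant` (K8: `tracelessFields`, the linear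
`∇⁺_μ` ∕ `S_μ†−1` restricted to traceless fields, Faddeev–Popov operator bijective at the ladder); consumes lit-4's `DiscreteHodgeDeterminant`
(`covGrad`, `covDiv`, `isCompl_range_covGrad_ker_covDiv`, `covGrad_injective`, `finrank_ker_covDiv`) BY NAME.
* ★ `gaugeSliceEquiv`: at the twist-eating ladder `![A, B, Γ₂, Γ₃]` (`A, B` a unitary Weyl pair, `ω` primitive, `N(m+1) ≥ 2`, phase-flat unitary ladder) the map
  `(φ, y) ↦ grad φ + y` is a `ℂ`-LINEAR EQUIVALENCE `tracelessFields × ker(div) ≃ (Fin 4 → tracelessFields)` — the differential at `(1, 0)` of the orbit×slice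
  map `(g, y) ↦ g • (e^{y} · L)` in exponential coordinates (infinitesimal gauge transformations act by `φ ↦ −∇⁺φ` on the fluctuation), whose invertibility is
  the inverse-function-theorem input of the tubular-coordinates change of variables `hchart` in lit-4's `tendsto_laplaceMethod_fibred_chart` (M1b);
  `gaugeSliceEquiv_apply`; `finrank_coulombSlice`: `dim_ℂ ker(div) = 3 · dim_ℂ tracelessFields` (three transverse polarisations).
NOT here (honest scope): the nonlinear map itself, its strict differentiability, the inverse function theorem, the Haar densities and the `hchart` identity
(M1b proper); anything uniform in `β` (M3); the cluster expansion (M4); T1-box 0∕1, T1 proper 0∕1.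

HONEST FRAMING: finite-dimensional linear algebra on one box; nothing here bears on `IRcof`, `IR`, or the Yang–Mills mass gap (Clay: NOT proved); R4 =
`BalabanLadder.UV` only.  References: M. García Pérez, A. González-Arroyo, M. Okawa, JHEP 10 (2017) 150 §2.2, §2.5; I. Montvay, G. Münster, *Quantum
Fields on a Lattice* §3.2.5 (gauge fixing and the Faddeev–Popov construction).
-/

set_option autoImplicit false

noncomputable section

open scoped Matrix
open Finset
open Literature.MathematicalPhysics.QuantumFieldTheory Literature.MathematicalPhysics.QuantumLattice
open Literature.Analysis.OperatorTheory

namespace Summit.QuantumFields.YangMills.Cruxes.IRcof.TwistedSlab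

variable {N : ℕ} [NeZero N] {m n₂' n₃' : ℕ} {A B : Matrix (Fin N) (Fin N) ℂ} {ω : ℂ} {Γ₂ Γ₃ : Matrix (Fin N) (Fin N) ℂ}

/-- ★ **GAUGE MODES ⊕ COULOMB SLICE = ALL FLUCTUATIONS, as a linear isomorphism `(φ, y) ↦ grad φ + y`** at the twist-eating ladder (`A, B` a unitary
Weyl pair `AB = ω·BA`, `ω` a primitive `N`-th root of unity, the ladder `![A, B, Γ₂, Γ₃]` unitary and phase-flat, `N(m+1) ≥ 2`): the discrete Hodge
decomposition of lit-4 (`isCompl_range_covGrad_ker_covDiv`) with `grad` injective (no infinitesimal gauge zero mode, K8) packaged as a `LinearEquiv`.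
[cite: GarciaperezGonzalezarroyoOkawa2017, §2.2, §2.5] [cite: MontvayMunster1994, §3.2.5 p. 122] -/
def gaugeSliceEquiv (hAu : A ∈ Matrix.unitaryGroup (Fin N) ℂ) (hBu : B ∈ Matrix.unitaryGroup (Fin N) ℂ) (hω : IsPrimitiveRoot ω N)
    (hAB : A * B = ω • (B * A)) (hNm : 2 ≤ N * (m + 1))
    (hU : ∀ e, ladderField (n₀ := m + 1) (n₁ := m + 1) (n₂ := n₂') (n₃ := n₃') ![A, B, Γ₂, Γ₃] e ∈ Matrix.unitaryGroup (Fin N) ℂ) :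
    (tracelessFields N (m + 1) (m + 1) n₂' n₃' × LinearMap.ker (DiscreteWeitzenboeck.covDiv (tracelessDadj hU))) ≃ₗ[ℂ]
      (Fin 4 → tracelessFields N (m + 1) (m + 1) n₂' n₃') :=
  ((LinearEquiv.ofInjective (DiscreteWeitzenboeck.covGrad (tracelessD hU))
      (DiscreteWeitzenboeck.covGrad_injective (covLaplacian_traceless_injective_ladder hAu hBu hω hAB hNm hU))).prodCongr
    (LinearEquiv.refl ℂ _)).trans
    (Submodule.prodEquivOfIsCompl _ _
      (DiscreteWeitzenboeck.isCompl_range_covGrad_ker_covDiv (covLaplacian_traceless_bijective_ladder hAu hBu hω hAB hNm hU)))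

/-- ★ `gaugeSliceEquiv (φ, y) = grad φ + y`. [cite: GarciaperezGonzalezarroyoOkawa2017, §2.5] -/
theorem gaugeSliceEquiv_apply (hAu : A ∈ Matrix.unitaryGroup (Fin N) ℂ) (hBu : B ∈ Matrix.unitaryGroup (Fin N) ℂ) (hω : IsPrimitiveRoot ω N)
    (hAB : A * B = ω • (B * A)) (hNm : 2 ≤ N * (m + 1))
    (hU : ∀ e, ladderField (n₀ := m + 1) (n₁ := m + 1) (n₂ := n₂') (n₃ := n₃') ![A, B, Γ₂, Γ₃] e ∈ Matrix.unitaryGroup (Fin N) ℂ)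
    (φ : tracelessFields N (m + 1) (m + 1) n₂' n₃') (y : LinearMap.ker (DiscreteWeitzenboeck.covDiv (tracelessDadj hU))) :
    gaugeSliceEquiv hAu hBu hω hAB hNm hU (φ, y) = DiscreteWeitzenboeck.covGrad (tracelessD hU) φ + (y : Fin 4 → tracelessFields N (m + 1) (m + 1) n₂' n₃') := by
  simp [gaugeSliceEquiv, Submodule.coe_prodEquivOfIsCompl', LinearEquiv.ofInjective_apply]

/-- Components: `(gaugeSliceEquiv (φ, y)) μ = ∇⁺_μ φ + y μ` as site fields. [cite: GarciaperezGonzalezarroyoOkawa2017, §2.5] -/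
theorem coe_gaugeSliceEquiv_apply (hAu : A ∈ Matrix.unitaryGroup (Fin N) ℂ) (hBu : B ∈ Matrix.unitaryGroup (Fin N) ℂ) (hω : IsPrimitiveRoot ω N)
    (hAB : A * B = ω • (B * A)) (hNm : 2 ≤ N * (m + 1))
    (hU : ∀ e, ladderField (n₀ := m + 1) (n₁ := m + 1) (n₂ := n₂') (n₃ := n₃') ![A, B, Γ₂, Γ₃] e ∈ Matrix.unitaryGroup (Fin N) ℂ)
    (φ : tracelessFields N (m + 1) (m + 1) n₂' n₃') (y : LinearMap.ker (DiscreteWeitzenboeck.covDiv (tracelessDadj hU))) (μ : Fin 4) :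
    ((gaugeSliceEquiv hAu hBu hω hAB hNm hU (φ, y) μ : tracelessFields N (m + 1) (m + 1) n₂' n₃') :
        FinTorusSite (m + 1) (m + 1) n₂' n₃' → Matrix (Fin N) (Fin N) ℂ) =
      fun x => covDeriv (ladderField ![A, B, Γ₂, Γ₃]) μ (φ : FinTorusSite (m + 1) (m + 1) n₂' n₃' → Matrix (Fin N) (Fin N) ℂ) x +
        ((y : Fin 4 → tracelessFields N (m + 1) (m + 1) n₂' n₃') μ : FinTorusSite (m + 1) (m + 1) n₂' n₃' → Matrix (Fin N) (Fin N) ℂ) x := by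
  rw [gaugeSliceEquiv_apply]
  rfl

/-- **Three transverse polarisations**: `dim_ℂ ker(div) = 3 · dim_ℂ tracelessFields` at the twist-eating ladder (lit-4 `finrank_ker_covDiv`, `#ι = 4`).
[cite: MontvayMunster1994, §3.3 (3.229), (3.245)] -/
theorem finrank_coulombSlice (hAu : A ∈ Matrix.unitaryGroup (Fin N) ℂ) (hBu : B ∈ Matrix.unitaryGroup (Fin N) ℂ) (hω : IsPrimitiveRoot ω N)
    (hAB : A * B = ω • (B * A)) (hNm : 2 ≤ N * (m + 1))
    (hU : ∀ e, ladderField (n₀ := m + 1) (n₁ := m + 1) (n₂ := n₂') (n₃ := n₃') ![A, B, Γ₂, Γ₃] e ∈ Matrix.unitaryGroup (Fin N) ℂ) :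
    Module.finrank ℂ (LinearMap.ker (DiscreteWeitzenboeck.covDiv (tracelessDadj hU))) =
      3 * Module.finrank ℂ (tracelessFields N (m + 1) (m + 1) n₂' n₃') := by
  have h := DiscreteWeitzenboeck.finrank_ker_covDiv (covLaplacian_traceless_bijective_ladder hAu hBu hω hAB hNm hU)
  rw [Fintype.card_fin] at h
  exact h

/-- **Gauge modes**: `dim_ℂ im(grad) = dim_ℂ tracelessFields` (one longitudinal polarisation; `grad` injective). [cite: MontvayMunster1994, §3.3 (3.247)] -/
theorem finrank_gaugeModes (hAu : A ∈ Matrix.unitaryGroup (Fin N) ℂ) (hBu : B ∈ Matrix.unitaryGroup (Fin N) ℂ) (hω : IsPrimitiveRoot ω N)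
    (hAB : A * B = ω • (B * A)) (hNm : 2 ≤ N * (m + 1))
    (hU : ∀ e, ladderField (n₀ := m + 1) (n₁ := m + 1) (n₂ := n₂') (n₃ := n₃') ![A, B, Γ₂, Γ₃] e ∈ Matrix.unitaryGroup (Fin N) ℂ) :
    Module.finrank ℂ (LinearMap.range (DiscreteWeitzenboeck.covGrad (tracelessD hU))) =
      Module.finrank ℂ (tracelessFields N (m + 1) (m + 1) n₂' n₃') :=
  DiscreteWeitzenboeck.finrank_range_covGrad (covLaplacian_traceless_injective_ladder hAu hBu hω hAB hNm hU)

end Summit.QuantumFields.YangMills.Cruxes.IRcof.TwistedSlab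

end
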